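import Summits.QuantumFields.YangMills.Theorems.BalabanUVNodesN15PerCubeGreenCutGramTwoGridDefect
import Summits.QuantumFields.YangMills.Theorems.BalabanUVNodesN15PerCubeGreenTwoGridPairingGeometry
import Summits.QuantumFields.YangMills.Theorems.BalabanUVNodesN15CovariantTwoGridSpeciesFitC
import Summits.QuantumFields.YangMills.Theorems.BalabanUVNodesN15PerCubeGreenTwoGridStepLettersOfReg335
import HarnessLib

/-!
# N15 = NE2, road (c) — PROGRAMME (PC) «[B9] Sect. C FOR THE LANDAU LETTER WITH PER-CUBE GAUGES (3.35) AS PRINTED», (PC-E) (C6-e) (G5′): THE CLOSING ASSEMBLY WITH THE GRAM DEFECT PRODUCED — THE TWO-GRID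
# η-DEFECT OF THE SCALAR COVARIANT GREEN's FUNCTIONS `G′(U′)` ∕ `G′(U)` FROM ONE PRINTED (3.35) DATUM PER CUBE, the coarse field being the straight fine holonomy (King's covariant
# pairing) and the cube gauges PRODUCED ([B9] (3.35) ⟹ `∃ u` axial): n15-c∕340 `uN_idef_scGreen_tr` with its letter rows `hQf hQρ hQc hF1 hF2 hC1 hC2` and its fits `hfitA`, `hfitC`
# (modulo the divergence-term fit `o_B`) AND its cut Gram perturbation defect `hDNV` DISCHARGED by n15-c∕341–352; what stays displayed is the componentwise divergence fit `o_B`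
# (beyond-(3.35) regularity, [B9] (3.36)) and the numeric thresholds (dag-n15-c g32, n15-c∕353)

Cell `pub-ymgap`, seat `pub-ymgap-dag-n15-c` (generation g32; R134 (a) seat, strategy s1 «first missing estimate»; HUMAN RULING D-0062; chair R424 venue).
`bears_on: R4∕N15 · K3⁸ SpineGivenEndpointR13SepCoPHV (stmt-QuantumFields-27366)`; filed `--kind proof --supports stmt-QuantumFields-27366 --as helper` — COUNT-NEUTRAL.
ONE THEOREM, 0 `def`, 0 `sorry`; pure composition BY NAME of n15-c∕352 `hasMaj_idef_scNV_pairing` (the Gram defect), n15-c∕340 `uN_idef_scGreen_tr` (✓p799051), n15-c∕341 `norm_scGauged_pairing_letters` (✓p799454), n15-c∕343 `sc_hfitA_of_pairing`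
(✓p799949), n15-c∕344 `sc_hfitC_of_pairing` (✓p800355), n15-c∕346 `uN_exists_gauge_allLetters_of_reg335Cube` (✓p800712), n15-c∕347 `sc_collar_mem` ∕ `tdist_scBlk'_line_le` ∕
`sc_hΩ_of_stepLetters` (p801070), n15-c∕185a `conjTranspose_mprod_mul_self`, dag-n15-a `scBlk_mem_cvSk_of_scChi_ne_zero` ∕ `scBlk_kingPr_mem_cvSk_of_scChi'_ne_zero`.  Nothing in the tree
is modified, no landed name re-declared.

WHAT IT SAYS.  ★★★ `uN_idef_scGreen_tr_of_reg335_pairing` (n15-c∕348 with `hDNV` PRODUCED): for the (PC) site carriers at scales `η = L^{-k}`, `η′ = L^{-(r+k)}`, a fine bond field `U′` (unitary-group valued) and, per cube `k` of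
the cover, ONE regularity datum `Reg335Cube τ′ U′ η′ (Q k) ξ C` ([B9] (3.35) as typed: an axial gauge with `|A| ≤ C∕ξ`-type letters) on any site set `Q k` containing every fine site
whose unit block is within `5` blocks of the plateau `𝔅_k`; the COARSE field is the straight fine holonomy `U_μ(y) = Π_{t<L^r}U′_μ(σy + te′_μ)` (King's covariant pairing, director
ruling I.20786∕I.20907); THEN there are cube gauges `u′_k` (unitary; from (3.35), n15-c∕346) such that — given the displayed componentwise divergence fit `o_B` (n15-c∕344's `hB`)
and the numeric thresholds (the Gram defect rate `o_N` now written out inside the threshold `hole`) — the two-grid η-defect of the glued scalar covariant Green's functions through the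
covariant transport obeys `D·(L^{-k∕4} + o + ((1 + |ι|η′P₁)^{(d+1)(L^r−1)} − 1))·e^{−(δ∕16)dist}`, with the letters `p = ((1+η′p_f)^{L^r} − 1)∕η`, `q = q_f(1+η′p_f)^{L^r}`,
`p_f = (C∕ξ)e^{η′C∕ξ}`, `q_f = (C∕ξ²)e^{η′C∕ξ}` and the oscillation `Ω = ((d+1)(L^r−1) + L^r + 1)·η′²q_f` written out in the thresholds.

HOW.  `u′_k` and the fine pointwise ∕ all-direction step letters from n15-c∕346 on `Q k`; the letter sets `Qf k = {z : dist(B′(z), 𝔅_k) ≤ 3}`, `Qc k = {x : dist(B(x), 𝔅_k) ≤ 1}` and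
their rows `hQf hQρ hQc` by n15-c∕347 (`sc_collar_mem`: the two-step collar of a `Qf`-site lies in `Q k`); the coarse letters `hC1 hC2` by n15-c∕341 along the fine lines
(`tdist_scBlk'_line_le`); `hfitA` by n15-c∕343 with the oscillation row from n15-c∕347 `sc_hΩ_of_stepLetters`; `hfitC` by n15-c∕344 (same, plus the displayed `o_B`); `p_f ≤ p`
(Bernoulli) and `q_f ≤ q` make one pair of letters serve both grids.

HONEST FRAMING ∕ LIMITS.  MODEL two-grid setting: the coarse field IS the fine holonomy (pairing (i) covariant), the (3.35) datum is the tree's typed SHAPE `Reg335Cube` ([B9] (3.35)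
p.396; NOT Bałaban's inductive regularity theorem), the remaining displayed row is `o_B` (LOCATED: needs (3.36)-strength componentwise regularity, [B9] p.396 «later on we will have
to assume (3.36) also»), plus numeric thresholds; [B9] Thm 3.14 (pp.426–427) is the DOMAIN-change
theorem and is cited as a template only.  NE2⁺ NOT PRINTED, NOT proved; N15 of record untouched (DISCHARGED AS CONSUMED, p687738); K3⁸ OPEN; counts of record UNMOVED (typed 28∕28 ·
discharged 8∕27); one finite 𝕋⁴ at fixed ε per index — NOT infinite volume, NOT OS on ℝ⁴, NOT a mass gap, NOT Clay.  Restate-immune (no Theses import).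
-/

set_option autoImplicit false

noncomputable section

open scoped BigOperators Matrix Matrix.Norms.L2Operator
open Finset

namespace Summit.QuantumFields.YangMills.BalabanUVNodes.N15.Gluing

open Real
open Literature.MathematicalPhysics.QuantumFieldTheory.Balaban1983to89
open Literature.MathematicalPhysics.QuantumFieldTheory.Balaban1983to89.B5Prop11Plancherel (Tor fine unitVec)
open Literature.MathematicalPhysics.QuantumFieldTheory.Balaban1983to89.B11SectG (BlockNorm HasMaj)
open Literature.MathematicalPhysics.QuantumFieldTheory.Balaban1983to89.T4EtaRateDefect (idef)
open Literature.MathematicalPhysics.QuantumFieldTheory.Balaban1983to89.T4EtaRateCoeffDefect (pull)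
open Literature.MathematicalPhysics.QuantumFieldTheory.Balaban1983to89.B6Prop26Gluing (mulOp)
open Literature.MathematicalPhysics.QuantumFieldTheory.Balaban1983to89.B6UnitTorusCarrier (unitTorusGeo)
open Literature.MathematicalPhysics.QuantumFieldTheory.Balaban1983to89.B5SiteBridgeP12 (MP)
open Literature.MathematicalPhysics.QuantumFieldTheory.Balaban1983to89.B9Eq335RegularityClasses (Reg335Cube)
open Literature.MathematicalPhysics.QuantumFieldTheory.King1986 (aK)
open Literature.MathematicalPhysics.QuantumFieldTheory.King1986.Torus (blockOf tdistT_self)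
open Literature.Barriers.QuantumFields (traceForm)
open Summit.QuantumFields.YangMills.BalabanUVNodes.N15.BackgroundLayer (tCoefA tCoefC)
open Summit.QuantumFields.YangMills.BalabanUVNodes.N15.VectorPiece (kingPr)
open Summit.QuantumFields.YangMills.BalabanUVNodes.N15.MatrixSpecies (coordMat basisConst basisConst_nonneg liftBlk liftMap)
open Summit.QuantumFields.YangMills.BalabanUVNodes.N15.CurvedSpecies (gaugePair uN_exists_gauge_allLetters_of_reg335Cube)
open Summit.QuantumFields.YangMills.BalabanUVNodes.N15.CovAvg (mprod kingSec ctauS conjTranspose_mprod_mul_self)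

variable {d : ℕ}

section Final

variable {L : ℕ} [NeZero L]

set_option maxHeartbeats 1600000 in
/-- ★★★ **THE TWO-GRID η-DEFECT OF THE SCALAR COVARIANT GREEN's FUNCTIONS FROM ONE PRINTED (3.35) DATUM PER CUBE, GRAM DEFECT PRODUCED** (the coarse field = the straight fine
holonomy; cube gauges PRODUCED; displayed: ONLY the componentwise divergence fit `o_B` and numeric thresholds).  See the module docstring for the reading and the limits.
[cite: Balaban1985BackgroundPropagators, (3.35) p.396, (3.51)–(3.52) p.400, Thm 3.14 pp.426–427 (shapes ∕ template); Balaban1985Averaging, (124)–(125) p.36 (pairing: shape); King1986,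
p.664 (pairing convention)] -/
theorem uN_idef_scGreen_tr_of_reg335_pairing (hL : Odd L ∧ 1 < L) (hL7 : 7 ≤ L) {a₀ : ℝ} (ha₀ : 0 < a₀) (ι : Type) [Fintype ι] [DecidableEq ι] :
    ∃ δ w₀ R₀ D : ℝ, 0 < δ ∧ 0 < R₀ ∧ ∀ (mv kk r : ℕ), 1 ≤ kk → 1 ≤ r → w₀ ≤ ((L ^ mv : ℕ) : ℝ) →
      ∀ {mm : Type} [Fintype mm] [DecidableEq mm] [Nonempty mm] (e : Matrix mm mm ℂ ≃L[ℝ] (ι → ℝ)), (∀ A B : Matrix mm mm ℂ, traceForm A B = e A ⬝ᵥ e B) →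
      ∀ (U' : Fin (d + 1) → ScX' d L mv kk r hL → (Matrix mm mm ℂ)ˣ), (∀ μ x', (U' μ x' : Matrix mm mm ℂ) ∈ Matrix.unitaryGroup mm ℂ) →
      -- ONE (3.35) datum per cube, on a site set containing the five-block collar of the plateau
      ∀ (Q : (Fin (d + 1) → ZMod (2 * L)) → Set (ScX' d L mv kk r hL)) (ξ C : ℝ), 0 < ξ → 0 ≤ C →
        (∀ k, Reg335Cube (scShift' d L mv kk r hL) U' ((((L ^ r * L ^ kk : ℕ) : ℝ))⁻¹) (Q k) ξ C) →
        (∀ k z, (∃ y ∈ cvSk d L mv kk hL k, (unitTorusGeo L kk (cvM d L mv kk hL)).dist (scBlk' d L mv kk r hL z) y ≤ 5) → z ∈ Q k) →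
      ∀ (rV oV o oB : ℝ), 0 ≤ rV → 0 ≤ oV → 0 ≤ oB →
        -- numeric thresholds (the letters `p`, `q`, `Ω` written out)
        Fintype.card ι * (@basisConst ι _ (Matrix mm mm ℂ) Matrix.frobeniusNormedAddCommGroup Matrix.frobeniusNormedSpace e * (2 * Real.sqrt (Fintype.card mm)) * (Real.sqrt (Fintype.card mm) * (((1 + ((((L ^ r * L ^ kk : ℕ) : ℝ))⁻¹) * ((C / ξ) * Real.exp (((((L ^ r * L ^ kk : ℕ) : ℝ))⁻¹) * (C / ξ)))) ^ (L ^ r) - 1) / ((((L ^ kk : ℕ) : ℝ))⁻¹)))) ≤ rV →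
        Fintype.card ι * (Fintype.card (Fin (d + 1)) * (Fintype.card ι * (@basisConst ι _ (Matrix mm mm ℂ) Matrix.frobeniusNormedAddCommGroup Matrix.frobeniusNormedSpace e * (2 * Real.sqrt (Fintype.card mm)) * (Real.sqrt (Fintype.card mm) * (((1 + ((((L ^ r * L ^ kk : ℕ) : ℝ))⁻¹) * ((C / ξ) * Real.exp (((((L ^ r * L ^ kk : ℕ) : ℝ))⁻¹) * (C / ξ)))) ^ (L ^ r) - 1) / ((((L ^ kk : ℕ) : ℝ))⁻¹)))) ^ 2 + (@basisConst ι _ (Matrix mm mm ℂ) Matrix.frobeniusNormedAddCommGroup Matrix.frobeniusNormedSpace e * (2 * Real.sqrt (Fintype.card mm)) * (Real.sqrt (Fintype.card mm) * (((C / ξ ^ 2) * Real.exp (((((L ^ r * L ^ kk : ℕ) : ℝ))⁻¹) * (C / ξ))) * (1 + ((((L ^ r * L ^ kk : ℕ) : ℝ))⁻¹) * ((C / ξ) * Real.exp (((((L ^ r * L ^ kk : ℕ) : ℝ))⁻¹) * (C / ξ)))) ^ (L ^ r)))))) ≤ rV →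
        Fintype.card ι * (((L ^ r * L ^ kk : ℕ) : ℝ) * (@basisConst ι _ (Matrix mm mm ℂ) Matrix.frobeniusNormedAddCommGroup Matrix.frobeniusNormedSpace e * (2 * Real.sqrt (Fintype.card mm)) * (Real.sqrt (Fintype.card mm) * ((((d + 1 : ℕ) : ℝ) * ((L ^ r - 1 : ℕ) : ℝ) + (L ^ r : ℕ) + 1) * (((((L ^ r * L ^ kk : ℕ) : ℝ))⁻¹) ^ 2 * ((C / ξ ^ 2) * Real.exp (((((L ^ r * L ^ kk : ℕ) : ℝ))⁻¹) * (C / ξ)))))) + ((1 + Fintype.card ι * (((((L ^ r * L ^ kk : ℕ) : ℝ))⁻¹) * (@basisConst ι _ (Matrix mm mm ℂ) Matrix.frobeniusNormedAddCommGroup Matrix.frobeniusNormedSpace e * (2 * Real.sqrt (Fintype.card mm)) * (Real.sqrt (Fintype.card mm) * (((1 + ((((L ^ r * L ^ kk : ℕ) : ℝ))⁻¹) * ((C / ξ) * Real.exp (((((L ^ r * L ^ kk : ℕ) : ℝ))⁻¹) * (C / ξ)))) ^ (L ^ r) - 1) / ((((L ^ kk : ℕ) : ℝ))⁻¹))))))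 ^ (L ^ r) - 1) * (((((L ^ r * L ^ kk : ℕ) : ℝ))⁻¹) * (@basisConst ι _ (Matrix mm mm ℂ) Matrix.frobeniusNormedAddCommGroup Matrix.frobeniusNormedSpace e * (2 * Real.sqrt (Fintype.card mm)) * (Real.sqrt (Fintype.card mm) * (((1 + ((((L ^ r * L ^ kk : ℕ) : ℝ))⁻¹) * ((C / ξ) * Real.exp (((((L ^ r * L ^ kk : ℕ) : ℝ))⁻¹) * (C / ξ)))) ^ (L ^ r) - 1) / ((((L ^ kk : ℕ) : ℝ))⁻¹))))))) ≤ oV →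
        Fintype.card ι * (Fintype.card (Fin (d + 1)) * (oB + Fintype.card ι * ((((L ^ r * L ^ kk : ℕ) : ℝ) * (@basisConst ι _ (Matrix mm mm ℂ) Matrix.frobeniusNormedAddCommGroup Matrix.frobeniusNormedSpace e * (2 * Real.sqrt (Fintype.card mm)) * (Real.sqrt (Fintype.card mm) * ((((d + 1 : ℕ) : ℝ) * ((L ^ r - 1 : ℕ) : ℝ) + (L ^ r : ℕ) + 1) * (((((L ^ r * L ^ kk : ℕ) : ℝ))⁻¹) ^ 2 * ((C / ξ ^ 2) * Real.exp (((((L ^ r * L ^ kk : ℕ) : ℝ))⁻¹) * (C / ξ)))))) + ((1 + Fintype.card ι * (((((L ^ r * L ^ kk : ℕ) : ℝ))⁻¹) * (@basisConst ι _ (Matrix mm mm ℂ) Matrix.frobeniusNormedAddCommGroup Matrix.frobeniusNormedSpace e * (2 * Real.sqrt (Fintype.card mm)) * (Real.sqrt (Fintype.card mm) * (((1 + ((((L ^ r * L ^ kk : ℕ) : ℝ))⁻¹) * ((C / ξ) * Real.exp (((((L ^ r * L ^ kk : ℕ) : ℝ))⁻¹) * (C / ξ)))) ^ (L ^ r) -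 1) / ((((L ^ kk : ℕ) : ℝ))⁻¹)))))) ^ (L ^ r) - 1) * (((((L ^ r * L ^ kk : ℕ) : ℝ))⁻¹) * (@basisConst ι _ (Matrix mm mm ℂ) Matrix.frobeniusNormedAddCommGroup Matrix.frobeniusNormedSpace e * (2 * Real.sqrt (Fintype.card mm)) * (Real.sqrt (Fintype.card mm) * (((1 + ((((L ^ r * L ^ kk : ℕ) : ℝ))⁻¹) * ((C / ξ) * Real.exp (((((L ^ r * L ^ kk : ℕ) : ℝ))⁻¹) * (C / ξ)))) ^ (L ^ r) - 1) / ((((L ^ kk : ℕ) : ℝ))⁻¹))))))) * ((@basisConst ι _ (Matrix mm mm ℂ) Matrix.frobeniusNormedAddCommGroup Matrix.frobeniusNormedSpace e * (2 * Real.sqrt (Fintype.card mm)) * (Real.sqrt (Fintype.card mm) * (((1 + ((((L ^ r * L ^ kk : ℕ) : ℝ))⁻¹) * ((C / ξ) * Real.exp (((((L ^ r * L ^ kk : ℕ) : ℝ))⁻¹) * (C / ξ)))) ^ (L ^ r) - 1) / ((((L ^ kk : ℕ) : ℝ))⁻¹)))) + (((L ^ kk : ℕ) : ℝ) * (@basisConst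 ι _ (Matrix mm mm ℂ) Matrix.frobeniusNormedAddCommGroup Matrix.frobeniusNormedSpace e * (2 * Real.sqrt (Fintype.card mm)) * (Real.sqrt (Fintype.card mm) * ((1 + ((((L ^ r * L ^ kk : ℕ) : ℝ))⁻¹) * (((1 + ((((L ^ r * L ^ kk : ℕ) : ℝ))⁻¹) * ((C / ξ) * Real.exp (((((L ^ r * L ^ kk : ℕ) : ℝ))⁻¹) * (C / ξ)))) ^ (L ^ r) - 1) / ((((L ^ kk : ℕ) : ℝ))⁻¹))) ^ (L ^ r) - 1)))))))) ≤ oV →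
        rV * (1 + Fintype.card (Fin (d + 1) ⊕ Fin (d + 1))) + (a₀ * (Fintype.card ι * (Fintype.card ι * ((1 + rV * ((((L ^ kk : ℕ) : ℝ))⁻¹)) ^ ((d + 1) * L ^ kk) - 1) ^ 2 + 2 * ((1 + rV * ((((L ^ kk : ℕ) : ℝ))⁻¹)) ^ ((d + 1) * L ^ kk) - 1))) + a₀ * (Fintype.card ι * (Fintype.card ι * ((1 + rV * ((((L ^ r * L ^ kk : ℕ) : ℝ))⁻¹)) ^ ((d + 1) * (L ^ r * L ^ kk)) - 1) ^ 2 + 2 * ((1 + rV * ((((L ^ r * L ^ kk : ℕ) : ℝ))⁻¹)) ^ ((d + 1) * (L ^ r * L ^ kk)) - 1)))) ≤ R₀ → oV * (1 + Fintype.card (Fin (d + 1) ⊕ Fin (d + 1))) + (Fintype.card ι * (|aK a₀ (L : ℝ) (r + kk) - aK a₀ (L : ℝ) kk| * (1 + Fintype.card ι) + |aK a₀ (L : ℝ) kk| * (2 * Fintype.card ι * (@basisConst ι _ (Matrix mm mm ℂ) Matrix.frobeniusNormedAddCommGroup Matrix.frobeniusNormedSpace e * (2 * Real.sqrt (Fintype.card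 mm)) * (Real.sqrt (Fintype.card mm) * ((d + 1) * (d * ((((L ^ r * L ^ kk : ℕ) : ℝ)) * (((L ^ r : ℕ) : ℝ) * (((((L ^ r * L ^ kk : ℕ) : ℝ))⁻¹) ^ 2 * ((C / ξ ^ 2) * Real.exp (((((L ^ r * L ^ kk : ℕ) : ℝ))⁻¹) * (C / ξ)))))) + ((1 + (((((L ^ r * L ^ kk : ℕ) : ℝ))⁻¹) * ((C / ξ) * Real.exp (((((L ^ r * L ^ kk : ℕ) : ℝ))⁻¹) * (C / ξ))))) ^ (L ^ r) - 1)))))))) ≤ o →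
      ∃ u' : (Fin (d + 1) → ZMod (2 * L)) → ScX' d L mv kk r hL → Matrix mm mm ℂ, (∀ k x', (u' k x')ᴴ * u' k x' = 1) ∧
       (-- the componentwise divergence-term fit (displayed; beyond (3.35))
        (∀ k μ x', scChi d L mv kk hL k (kingPr L kk r (cvM d L mv kk hL) x') ≠ 0 → ∀ i j, |(((((((L ^ r * L ^ kk : ℕ) : ℝ))⁻¹))⁻¹ * (((((L ^ r * L ^ kk : ℕ) : ℝ))⁻¹))⁻¹) • (coordMat e (ContinuousLinearMap.mulLeftRight ℝ (Matrix mm mm ℂ) (u' k x' * (U' μ x' : Matrix mm mm ℂ) * (u' k (scShift' d L mv kk r hL μ x'))ᴴ) (u' k x' * (U' μ x' : Matrix mm mm ℂ) * (u' k (scShift' d L mv kk r hL μ x'))ᴴ)ᴴ) - coordMat e (ContinuousLinearMap.mulLeftRight ℝ (Matrix mm mm ℂ) (u' k ((scShift' d L mv kk r hL μ).symm x') * (U' μ ((scShift' d L mv kk r hL μ).symm x') : Matrix mm mm ℂ) * (u' k (scShift' d L mv kk r hL μ ((scShift' d L mv kk r hL μ).symm x')))ᴴ) (u' k ((scShift'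 d L mv kk r hL μ).symm x') * (U' μ ((scShift' d L mv kk r hL μ).symm x') : Matrix mm mm ℂ) * (u' k (scShift' d L mv kk r hL μ ((scShift' d L mv kk r hL μ).symm x')))ᴴ)ᴴ)) -
      ((((((L ^ kk : ℕ) : ℝ))⁻¹))⁻¹ * (((((L ^ kk : ℕ) : ℝ))⁻¹))⁻¹) • (coordMat e (ContinuousLinearMap.mulLeftRight ℝ (Matrix mm mm ℂ) (u' k (kingSec (cvM d L mv kk hL) L kk r (kingPr L kk r (cvM d L mv kk hL) x')) * mprod (fun t => (U' μ (kingSec (cvM d L mv kk hL) L kk r (kingPr L kk r (cvM d L mv kk hL) x') + t • unitVec (fine (L ^ r * L ^ kk) (cvM d L mv kk hL)) μ) : Matrix mm mm ℂ)) (L ^ r) * (u' k (kingSec (cvM d L mv kk hL) L kk r (scShift d L mv kk hL μ (kingPr L kk r (cvM d L mv kk hL) x'))))ᴴ) (u' k (kingSec (cvM d L mv kk hL) L kk r (kingPr L kk r (cvM d L mv kk hL) x')) * mprod (fun t => (U' μ (kingSec (cvM d L mv kk hL) L kk r (kingPr L kk r (cvM d L mv kk hL) x') + t • unitVec (fine (L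 ^ r * L ^ kk) (cvM d L mv kk hL)) μ) : Matrix mm mm ℂ)) (L ^ r) * (u' k (kingSec (cvM d L mv kk hL) L kk r (scShift d L mv kk hL μ (kingPr L kk r (cvM d L mv kk hL) x'))))ᴴ)ᴴ) - coordMat e (ContinuousLinearMap.mulLeftRight ℝ (Matrix mm mm ℂ) (u' k (kingSec (cvM d L mv kk hL) L kk r ((scShift d L mv kk hL μ).symm (kingPr L kk r (cvM d L mv kk hL) x'))) * mprod (fun t => (U' μ (kingSec (cvM d L mv kk hL) L kk r ((scShift d L mv kk hL μ).symm (kingPr L kk r (cvM d L mv kk hL) x')) + t • unitVec (fine (L ^ r * L ^ kk) (cvM d L mv kk hL)) μ) : Matrix mm mm ℂ)) (L ^ r) * (u' k (kingSec (cvM d L mv kk hL) L kk r (scShift d L mv kk hL μ ((scShift d L mv kk hL μ).symm (kingPr L kk r (cvM d L mv kk hL) x')))))ᴴ) (u' k (kingSec (cvM d L mv kk hL) L kk r ((scShift d L mv kk hL μ).symm (kingPr L kk r (cvM d L mv kk hL) x'))) * mprod (fun t => (U' μ (kingSec (cvM d L mv kk hL) L kk r ((scShift d L mv kk hL μ).symm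 (kingPr L kk r (cvM d L mv kk hL) x')) + t • unitVec (fine (L ^ r * L ^ kk) (cvM d L mv kk hL)) μ) : Matrix mm mm ℂ)) (L ^ r) * (u' k (kingSec (cvM d L mv kk hL) L kk r (scShift d L mv kk hL μ ((scShift d L mv kk hL μ).symm (kingPr L kk r (cvM d L mv kk hL) x')))))ᴴ)ᴴ))) i j| ≤ oB) →
        HasMaj (ScNorm d L mv kk hL ι) (BlockNorm.ofBlocks (unitTorusGeo L kk (cvM d L mv kk hL)) (liftBlk (scBlk d L mv kk hL ∘ kingPr L kk r (cvM d L mv kk hL)) ι))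
          (idef (ctauS (cvM d L mv kk hL) L kk r (fun μ x' => coordMat e (ContinuousLinearMap.mulLeftRight ℝ (Matrix mm mm ℂ) ((U' μ x' : Matrix mm mm ℂ)) ((U' μ x' : Matrix mm mm ℂ))ᴴ))) (ctauS (cvM d L mv kk hL) L kk r (fun μ x' => coordMat e (ContinuousLinearMap.mulLeftRight ℝ (Matrix mm mm ℂ) ((U' μ x' : Matrix mm mm ℂ)) ((U' μ x' : Matrix mm mm ℂ))ᴴ))) (scGlued' d L mv kk r hL (aK a₀ (L : ℝ) (r + kk) * (((L ^ r * L ^ kk : ℕ) : ℝ)) ^ (d + 1)) ((((L ^ r * L ^ kk : ℕ) : ℝ))⁻¹) ι e u' (fun μ z => (U' μ z : Matrix mm mm ℂ)) (scP' d L mv kk r hL (aK a₀ (L : ℝ) (r + kk) * (((L ^ r * L ^ kk : ℕ) : ℝ)) ^ (d + 1)) ι e (fun μ z => (U' μ z : Matrix mm mm ℂ))) (scNV' d L mv kk r hL (aK a₀ (L : ℝ) (r + kk) * (((L ^ r * L ^ kk : ℕ) : ℝ)) ^ (d + 1)) ι e u' (fun μ z => (U' μ z : Matrix mm mm ℂ))))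 (scGlued d L mv kk hL (aK a₀ (L : ℝ) kk * (((L ^ kk : ℕ) : ℝ)) ^ (d + 1)) ((((L ^ kk : ℕ) : ℝ))⁻¹) ι e (fun k x => u' k (kingSec (cvM d L mv kk hL) L kk r x)) (fun μ y => mprod (fun t => (U' μ (kingSec (cvM d L mv kk hL) L kk r y + t • unitVec (fine (L ^ r * L ^ kk) (cvM d L mv kk hL)) μ) : Matrix mm mm ℂ)) (L ^ r)) (scP d L mv kk hL (aK a₀ (L : ℝ) kk * (((L ^ kk : ℕ) : ℝ)) ^ (d + 1)) ι e (fun μ y => mprod (fun t => (U' μ (kingSec (cvM d L mv kk hL) L kk r y + t • unitVec (fine (L ^ r * L ^ kk) (cvM d L mv kk hL)) μ) : Matrix mm mm ℂ)) (L ^ r))) (scNV d L mv kk hL (aK a₀ (L : ℝ) kk * (((L ^ kk : ℕ) : ℝ)) ^ (d + 1)) ι e (fun k x => u' k (kingSec (cvM d L mv kk hL) L kk r x)) (fun μ y => mprod (fun t => (U' μ (kingSec (cvM d L mv kk hL) L kk r y + t • unitVec (fine (L ^ r * L ^ kk) (cvM d L mv kk hL)) μ) : Matrix mm mm ℂ))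 (L ^ r)))))
          (fun y y' => D * (((L : ℝ) ^ kk) ^ (-(1 / 4 : ℝ)) + (o + ((1 + (Fintype.card ι * (((((L ^ r * L ^ kk : ℕ) : ℝ))⁻¹) * (@basisConst ι _ (Matrix mm mm ℂ) Matrix.frobeniusNormedAddCommGroup Matrix.frobeniusNormedSpace e * (2 * Real.sqrt (Fintype.card mm)) * (Real.sqrt (Fintype.card mm) * (((1 + ((((L ^ r * L ^ kk : ℕ) : ℝ))⁻¹) * ((C / ξ) * Real.exp (((((L ^ r * L ^ kk : ℕ) : ℝ))⁻¹) * (C / ξ)))) ^ (L ^ r) - 1) / ((((L ^ kk : ℕ) : ℝ))⁻¹))))))) ^ ((d + 1) * (L ^ r - 1)) - 1))) * Real.exp (-(δ / 16 * (unitTorusGeo L kk (cvM d L mv kk hL)).dist y y')))) := by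
  obtain ⟨δ, w₀, R₀, D, hδ, hR₀, H⟩ := uN_idef_scGreen_tr (d := d) hL hL7 ha₀ ι
  have hL3 : 3 ≤ L := (by omega); have hLpos : 0 < L := (by omega)
  refine ⟨δ, max w₀ 2, R₀, D, hδ, hR₀, fun mv kk r hk hr hw₀ => ?_⟩
  intro mm _ _ _ e he U' hU'g Q ξ C hξ hC h335 hQ rV oV o oB hrV hoV hoB hrA hrC hoA hoC hRle hole
  have hw₀' : w₀ ≤ ((L ^ mv : ℕ) : ℝ) := (le_max_left _ _).trans hw₀
  have hW2 : 2 ≤ L ^ mv := by have h := (le_max_right w₀ 2).trans hw₀; exact_mod_cast h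
  have hη : (0 : ℝ) < ((((L ^ kk : ℕ) : ℝ))⁻¹) := inv_pos.mpr (Nat.cast_pos.mpr (pow_pos hLpos kk))
  have hη' : (0 : ℝ) < ((((L ^ r * L ^ kk : ℕ) : ℝ))⁻¹) := inv_pos.mpr (Nat.cast_pos.mpr (Nat.mul_pos (pow_pos hLpos r) (pow_pos hLpos kk)))
  have hM : ∀ ν, cvM d L mv kk hL ν = 2 * L * L ^ mv := MP_succ_eq L mv kk hL
  have hm₁ : 2 * L ^ mv ≤ coverMargin L mv := two_mul_le_coverMargin hL7 mv
  have hfitI : coverMargin L mv - 2 * L ^ mv + (6 * L ^ mv + 1) ≤ L * L ^ mv := coverMargin_inner_fit hL7 hW2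
  have hS0 : L * L ^ mv ≤ 2 * L * L ^ mv := (by rw [mul_assoc]; omega)
  have hLr : 0 < L ^ r := pow_pos hLpos r
  -- the cube gauges from (3.35) (n15-c∕346)
  have hex := fun k => uN_exists_gauge_allLetters_of_reg335Cube (scShift' d L mv kk r hL) U' hη' (h335 k)
  choose u' hu' hw1 hw2 using hex
  refine ⟨u', hu', fun hB => ?_⟩
  -- unitarity of the plain fields
  have hU' : ∀ μ (z : ScX' d L mv kk r hL), ((U' μ z : Matrix mm mm ℂ))ᴴ * (U' μ z : Matrix mm mm ℂ) = 1 := fun μ z => Matrix.mem_unitaryGroup_iff'.mp (hU'g μ z)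
  have hU : ∀ μ (x : ScX d L mv kk hL), (mprod (fun t => (U' μ (kingSec (cvM d L mv kk hL) L kk r x + t • unitVec (fine (L ^ r * L ^ kk) (cvM d L mv kk hL)) μ) : Matrix mm mm ℂ)) (L ^ r))ᴴ * mprod (fun t => (U' μ (kingSec (cvM d L mv kk hL) L kk r x + t • unitVec (fine (L ^ r * L ^ kk) (cvM d L mv kk hL)) μ) : Matrix mm mm ℂ)) (L ^ r) = 1 :=
    fun μ x => conjTranspose_mprod_mul_self (fun t _ => hU' μ _)
  -- the letters
  have hpf0 : (0 : ℝ) ≤ ((C / ξ) * Real.exp (((((L ^ r * L ^ kk : ℕ) : ℝ))⁻¹) * (C / ξ))) := by positivity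
  have hqf0 : (0 : ℝ) ≤ ((C / ξ ^ 2) * Real.exp (((((L ^ r * L ^ kk : ℕ) : ℝ))⁻¹) * (C / ξ))) := by positivity
  have hb0 : (0 : ℝ) ≤ (((((L ^ r * L ^ kk : ℕ) : ℝ))⁻¹) ^ 2 * ((C / ξ ^ 2) * Real.exp (((((L ^ r * L ^ kk : ℕ) : ℝ))⁻¹) * (C / ξ)))) := by positivity
  have hΩ0 : (0 : ℝ) ≤ ((((d + 1 : ℕ) : ℝ) * ((L ^ r - 1 : ℕ) : ℝ) + (L ^ r : ℕ) + 1) * (((((L ^ r * L ^ kk : ℕ) : ℝ))⁻¹) ^ 2 * ((C / ξ ^ 2) * Real.exp (((((L ^ r * L ^ kk : ℕ) : ℝ))⁻¹) * (C / ξ))))) := by positivity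
  have hpf_le : ((C / ξ) * Real.exp (((((L ^ r * L ^ kk : ℕ) : ℝ))⁻¹) * (C / ξ))) ≤ (((1 + ((((L ^ r * L ^ kk : ℕ) : ℝ))⁻¹) * ((C / ξ) * Real.exp (((((L ^ r * L ^ kk : ℕ) : ℝ))⁻¹) * (C / ξ)))) ^ (L ^ r) - 1) / ((((L ^ kk : ℕ) : ℝ))⁻¹)) := by
    have hB1 : 1 + ((L ^ r : ℕ) : ℝ) * (((((L ^ r * L ^ kk : ℕ) : ℝ))⁻¹) * ((C / ξ) * Real.exp (((((L ^ r * L ^ kk : ℕ) : ℝ))⁻¹) * (C / ξ)))) ≤ (1 + ((((L ^ r * L ^ kk : ℕ) : ℝ))⁻¹) * ((C / ξ) * Real.exp (((((L ^ r * L ^ kk : ℕ) : ℝ))⁻¹) * (C / ξ)))) ^ (L ^ r) := one_add_mul_le_pow (by nlinarith [mul_nonneg hη'.le hpf0]) _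
    have hsc : ((L ^ r : ℕ) : ℝ) * ((((L ^ r * L ^ kk : ℕ) : ℝ))⁻¹) = ((((L ^ kk : ℕ) : ℝ))⁻¹) := by
      rw [Nat.cast_mul, mul_inv, ← mul_assoc, mul_inv_cancel₀ (by positivity), one_mul]
    rw [le_div_iff₀ hη]
    calc ((C / ξ) * Real.exp (((((L ^ r * L ^ kk : ℕ) : ℝ))⁻¹) * (C / ξ))) * ((((L ^ kk : ℕ) : ℝ))⁻¹) = ((L ^ r : ℕ) : ℝ) * (((((L ^ r * L ^ kk : ℕ) : ℝ))⁻¹) * ((C / ξ) * Real.exp (((((L ^ r * L ^ kk : ℕ) : ℝ))⁻¹) * (C / ξ)))) := by rw [← hsc]; ring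
      _ ≤ (1 + ((((L ^ r * L ^ kk : ℕ) : ℝ))⁻¹) * ((C / ξ) * Real.exp (((((L ^ r * L ^ kk : ℕ) : ℝ))⁻¹) * (C / ξ)))) ^ (L ^ r) - 1 := by linarith
  have hqf_le : ((C / ξ ^ 2) * Real.exp (((((L ^ r * L ^ kk : ℕ) : ℝ))⁻¹) * (C / ξ))) ≤ (((C / ξ ^ 2) * Real.exp (((((L ^ r * L ^ kk : ℕ) : ℝ))⁻¹) * (C / ξ))) * (1 + ((((L ^ r * L ^ kk : ℕ) : ℝ))⁻¹) * ((C / ξ) * Real.exp (((((L ^ r * L ^ kk : ℕ) : ℝ))⁻¹) * (C / ξ)))) ^ (L ^ r)) := le_mul_of_one_le_right hqf0 (one_le_pow₀ (by nlinarith [mul_nonneg hη'.le hpf0]))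
  have hp : (0 : ℝ) ≤ (((1 + ((((L ^ r * L ^ kk : ℕ) : ℝ))⁻¹) * ((C / ξ) * Real.exp (((((L ^ r * L ^ kk : ℕ) : ℝ))⁻¹) * (C / ξ)))) ^ (L ^ r) - 1) / ((((L ^ kk : ℕ) : ℝ))⁻¹)) := hpf0.trans hpf_le
  have hq : (0 : ℝ) ≤ (((C / ξ ^ 2) * Real.exp (((((L ^ r * L ^ kk : ℕ) : ℝ))⁻¹) * (C / ξ))) * (1 + ((((L ^ r * L ^ kk : ℕ) : ℝ))⁻¹) * ((C / ξ) * Real.exp (((((L ^ r * L ^ kk : ℕ) : ℝ))⁻¹) * (C / ξ)))) ^ (L ^ r)) := hqf0.trans hqf_le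
  -- memberships (n15-c∕347)
  have hcol : ∀ k (z : ScX' d L mv kk r hL), (∃ y ∈ cvSk d L mv kk hL k, (unitTorusGeo L kk (cvM d L mv kk hL)).dist (scBlk' d L mv kk r hL z) y ≤ 3) → z ∈ Q k ∧ ∀ κ, scShift' d L mv kk r hL κ z ∈ Q k ∧ (scShift' d L mv kk r hL κ).symm z ∈ Q k ∧
      ∀ μ, scShift' d L mv kk r hL μ (scShift' d L mv kk r hL κ z) ∈ Q k ∧ scShift' d L mv kk r hL μ ((scShift' d L mv kk r hL κ).symm z) ∈ Q k := fun k z hz => sc_collar_mem (hQ k) z hz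
  -- fine letters on `Qf k = {dist(B′(z), 𝔅_k) ≤ 3}`
  have hF1f : ∀ k μ (z : ScX' d L mv kk r hL), (∃ y ∈ cvSk d L mv kk hL k, (unitTorusGeo L kk (cvM d L mv kk hL)).dist (scBlk' d L mv kk r hL z) y ≤ 3) → ‖u' k z * (U' μ z : Matrix mm mm ℂ) * (u' k (scShift' d L mv kk r hL μ z))ᴴ - 1‖ ≤ ((((L ^ r * L ^ kk : ℕ) : ℝ))⁻¹) * ((C / ξ) * Real.exp (((((L ^ r * L ^ kk : ℕ) : ℝ))⁻¹) * (C / ξ))) := fun k μ z hz => by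
    obtain ⟨hz0, hzs⟩ := hcol k z hz
    exact hw1 k μ z hz0 (hzs μ).1
  have hF2f : ∀ k μ (z : ScX' d L mv kk r hL), (∃ y ∈ cvSk d L mv kk hL k, (unitTorusGeo L kk (cvM d L mv kk hL)).dist (scBlk' d L mv kk r hL z) y ≤ 3) →
      ‖u' k z * (U' μ z : Matrix mm mm ℂ) * (u' k (scShift' d L mv kk r hL μ z))ᴴ - (u' k ((scShift' d L mv kk r hL μ).symm z) * (U' μ ((scShift' d L mv kk r hL μ).symm z) : Matrix mm mm ℂ) * (u' k (scShift' d L mv kk r hL μ ((scShift' d L mv kk r hL μ).symm z)))ᴴ)‖ ≤ ((((L ^ r * L ^ kk : ℕ) : ℝ))⁻¹) ^ 2 * ((C / ξ ^ 2) * Real.exp (((((L ^ r * L ^ kk : ℕ) : ℝ))⁻¹) * (C / ξ))) := fun k μ z hz => by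
    obtain ⟨hz0, hzs⟩ := hcol k z hz
    have e0 : scShift' d L mv kk r hL μ ((scShift' d L mv kk r hL μ).symm z) = z := Equiv.apply_symm_apply _ _
    set fA : ScX' d L mv kk r hL → Matrix mm mm ℂ := fun w => u' k w * (U' μ w : Matrix mm mm ℂ) * (u' k (scShift' d L mv kk r hL μ w))ᴴ with hfA
    have h : ‖fA (scShift' d L mv kk r hL μ ((scShift' d L mv kk r hL μ).symm z)) - fA ((scShift' d L mv kk r hL μ).symm z)‖ ≤ ((((L ^ r * L ^ kk : ℕ) : ℝ))⁻¹) ^ 2 * ((C / ξ ^ 2) * Real.exp (((((L ^ r * L ^ kk : ℕ) : ℝ))⁻¹) * (C / ξ))) :=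
      hw2 k μ μ ((scShift' d L mv kk r hL μ).symm z) (hzs μ).2.1 (by rw [e0]; exact hz0) (by rw [e0]; exact hz0) (by rw [e0]; exact (hzs μ).1)
    rw [e0] at h
    exact h
  have hstep : ∀ k κ μ (z : ScX' d L mv kk r hL), (∃ y ∈ cvSk d L mv kk hL k, (unitTorusGeo L kk (cvM d L mv kk hL)).dist (scBlk' d L mv kk r hL z) y ≤ 3) →
      ‖u' k (z + unitVec (fine (L ^ r * L ^ kk) (cvM d L mv kk hL)) κ) * (U' μ (z + unitVec (fine (L ^ r * L ^ kk) (cvM d L mv kk hL)) κ) : Matrix mm mm ℂ) * (u' k ((z + unitVec (fine (L ^ r * L ^ kk) (cvM d L mv kk hL)) κ) + unitVec (fine (L ^ r * L ^ kk) (cvM d L mv kk hL)) μ))ᴴ - (u' k z * (U' μ z : Matrix mm mm ℂ) * (u' k (z + unitVec (fine (L ^ r * L ^ kk) (cvM d L mv kk hL)) μ))ᴴ)‖ ≤ (((((L ^ r * L ^ kk : ℕ) : ℝ))⁻¹) ^ 2 * ((C / ξ ^ 2) * Real.exp (((((L ^ r * L ^ kk : ℕ) : ℝ))⁻¹) * (C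 / ξ)))) := fun k κ μ z hz => by
    obtain ⟨hz0, hzs⟩ := hcol k z hz
    exact hw2 k κ μ z hz0 (hzs κ).1 (hzs μ).1 ((hzs κ).2.2 μ).1
  -- block-distance witnesses
  have hblk : ∀ z : ScX' d L mv kk r hL, scBlk' d L mv kk r hL z = scBlk d L mv kk hL (kingPr L kk r (cvM d L mv kk hL) z) := fun z => (CovAvg.blockOf_kingPr (L := L) (k := kk) (m := r) (M := cvM d L mv kk hL) z).symm
  have hd0 : ∀ k (x' : ScX' d L mv kk r hL), scChi d L mv kk hL k (kingPr L kk r (cvM d L mv kk hL) x') ≠ 0 → ∃ y ∈ cvSk d L mv kk hL k, (unitTorusGeo L kk (cvM d L mv kk hL)).dist (scBlk' d L mv kk r hL x') y ≤ 0 := fun k x' hχ =>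
    ⟨_, scBlk_mem_cvSk_of_scChi_ne_zero hM hm₁ hfitI hS0 hχ, by rw [hblk x']; exact le_of_eq (tdistT_self _ _)⟩
  have hmono : ∀ k (z : ScX' d L mv kk r hL) (a : ℝ), a ≤ 3 → (∃ y ∈ cvSk d L mv kk hL k, (unitTorusGeo L kk (cvM d L mv kk hL)).dist (scBlk' d L mv kk r hL z) y ≤ a) → ∃ y ∈ cvSk d L mv kk hL k, (unitTorusGeo L kk (cvM d L mv kk hL)).dist (scBlk' d L mv kk r hL z) y ≤ 3 :=
    fun k z a ha ⟨y, hy, hd⟩ => ⟨y, hy, hd.trans ha⟩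
  have hline : ∀ k μ (x : ScX d L mv kk hL), (∃ y ∈ cvSk d L mv kk hL k, (unitTorusGeo L kk (cvM d L mv kk hL)).dist (scBlk d L mv kk hL x) y ≤ 1) → ∀ t < L ^ r, ∀ s ≤ L ^ r,
      ∃ y ∈ cvSk d L mv kk hL k, (unitTorusGeo L kk (cvM d L mv kk hL)).dist (scBlk' d L mv kk r hL (kingSec (cvM d L mv kk hL) L kk r x + t • unitVec (fine (L ^ r * L ^ kk) (cvM d L mv kk hL)) μ - s • unitVec (fine (L ^ r * L ^ kk) (cvM d L mv kk hL)) μ)) y ≤ 3 := fun k μ x ⟨y, hy, hd⟩ t ht s hs =>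
    hmono k _ (1 + 1) (by norm_num) (exists_tdist_le_succ (tdist_scBlk'_line_le μ x ht hs) ⟨y, hy, hd⟩)
  have hcut : ∀ k (x : ScX d L mv kk hL), scChi d L mv kk hL k x ≠ 0 → (∃ y ∈ cvSk d L mv kk hL k, (unitTorusGeo L kk (cvM d L mv kk hL)).dist (scBlk d L mv kk hL x) y ≤ 1) ∧ ∀ μ, ∃ y ∈ cvSk d L mv kk hL k, (unitTorusGeo L kk (cvM d L mv kk hL)).dist (scBlk d L mv kk hL ((scShift d L mv kk hL μ).symm x)) y ≤ 1 :=
    fun k x hχ => ⟨⟨_, scBlk_mem_cvSk_of_scChi_ne_zero hM hm₁ hfitI hS0 hχ, (le_of_eq (tdistT_self _ _)).trans zero_le_one⟩,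
      fun μ => ⟨_, scBlk_mem_cvSk_of_scChi_ne_zero hM hm₁ hfitI hS0 hχ, tdist_scBlk_scShift_symm_le μ x⟩⟩
  -- coarse letters along the fine lines (n15-c∕341)
  have hC : ∀ k μ (x : ScX d L mv kk hL), (∃ y ∈ cvSk d L mv kk hL k, (unitTorusGeo L kk (cvM d L mv kk hL)).dist (scBlk d L mv kk hL x) y ≤ 1) →
      ‖u' k (kingSec (cvM d L mv kk hL) L kk r x) * mprod (fun t => (U' μ (kingSec (cvM d L mv kk hL) L kk r x + t • unitVec (fine (L ^ r * L ^ kk) (cvM d L mv kk hL)) μ) : Matrix mm mm ℂ)) (L ^ r) * (u' k (kingSec (cvM d L mv kk hL) L kk r (scShift d L mv kk hL μ x)))ᴴ - 1‖ ≤ ((((L ^ kk : ℕ) : ℝ))⁻¹) * (((1 + ((((L ^ r * L ^ kk : ℕ) : ℝ))⁻¹) * ((C / ξ) * Real.exp (((((L ^ r * L ^ kk : ℕ) : ℝ))⁻¹) * (C / ξ)))) ^ (L ^ r) - 1) / ((((L ^ kk : ℕ) : ℝ))⁻¹)) ∧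
      ‖u' k (kingSec (cvM d L mv kk hL) L kk r x) * mprod (fun t => (U' μ (kingSec (cvM d L mv kk hL) L kk r x + t • unitVec (fine (L ^ r * L ^ kk) (cvM d L mv kk hL)) μ) : Matrix mm mm ℂ)) (L ^ r) * (u' k (kingSec (cvM d L mv kk hL) L kk r (scShift d L mv kk hL μ x)))ᴴ -
          u' k (kingSec (cvM d L mv kk hL) L kk r ((scShift d L mv kk hL μ).symm x)) * mprod (fun t => (U' μ (kingSec (cvM d L mv kk hL) L kk r ((scShift d L mv kk hL μ).symm x) + t • unitVec (fine (L ^ r * L ^ kk) (cvM d L mv kk hL)) μ) : Matrix mm mm ℂ)) (L ^ r) *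
            (u' k (kingSec (cvM d L mv kk hL) L kk r (scShift d L mv kk hL μ ((scShift d L mv kk hL μ).symm x))))ᴴ‖ ≤ ((((L ^ kk : ℕ) : ℝ))⁻¹) ^ 2 * (((C / ξ ^ 2) * Real.exp (((((L ^ r * L ^ kk : ℕ) : ℝ))⁻¹) * (C / ξ))) * (1 + ((((L ^ r * L ^ kk : ℕ) : ℝ))⁻¹) * ((C / ξ) * Real.exp (((((L ^ r * L ^ kk : ℕ) : ℝ))⁻¹) * (C / ξ)))) ^ (L ^ r)) := fun k μ x hx =>
    norm_scGauged_pairing_letters (hu' := hu' k) (fun μ z => (U' μ z : Matrix mm mm ℂ)) (U := (fun μ y => mprod (fun t => (U' μ (kingSec (cvM d L mv kk hL) L kk r y + t • unitVec (fine (L ^ r * L ^ kk) (cvM d L mv kk hL)) μ) : Matrix mm mm ℂ)) (L ^ r))) μ (fun y => rfl) (Qf := (fun k => {z : ScX' d L mv kk r hL | ∃ y ∈ cvSk d L mv kk hL k, (unitTorusGeo L kk (cvM d L mv kk hL)).dist (scBlk' d L mv kk r hL z) y ≤ 3}) k) hpf0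
      (fun z hz => hF1f k μ z hz) (fun z hz => hF2f k μ z hz) x (fun t ht s hs => hline k μ x hx t ht s hs)
  -- the oscillation row (n15-c∕347) and the two fits (n15-c∕343, n15-c∕344)
  have hΩ := sc_hΩ_of_stepLetters hM hm₁ hfitI hS0 u' (fun μ z => (U' μ z : Matrix mm mm ℂ)) hb0 hstep
  have hQlA : ∀ k (x' : ScX' d L mv kk r hL), scChi d L mv kk hL k (kingPr L kk r (cvM d L mv kk hL) x') ≠ 0 → ∀ μ t, t < L ^ r → kingSec (cvM d L mv kk hL) L kk r (kingPr L kk r (cvM d L mv kk hL) x') + t • unitVec (fine (L ^ r * L ^ kk) (cvM d L mv kk hL)) μ ∈ (fun k => {z : ScX' d L mv kk r hL | ∃ y ∈ cvSk d L mv kk hL k, (unitTorusGeo L kk (cvM d L mv kk hL)).dist (scBlk' d L mv kk r hL z) y ≤ 3}) k ∧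
      kingSec (cvM d L mv kk hL) L kk r ((scShift d L mv kk hL μ).symm (kingPr L kk r (cvM d L mv kk hL) x')) + t • unitVec (fine (L ^ r * L ^ kk) (cvM d L mv kk hL)) μ ∈ (fun k => {z : ScX' d L mv kk r hL | ∃ y ∈ cvSk d L mv kk hL k, (unitTorusGeo L kk (cvM d L mv kk hL)).dist (scBlk' d L mv kk r hL z) y ≤ 3}) k := fun k x' hχ μ t ht => by
    obtain ⟨h0, h1⟩ := hcut k _ hχ
    have ha := hline k μ _ h0 t ht 0 (Nat.zero_le _)
    have hb := hline k μ _ (h1 μ) t ht 0 (Nat.zero_le _)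
    rw [zero_smul, sub_zero] at ha hb
    exact ⟨ha, hb⟩
  have hQlC : ∀ k (x' : ScX' d L mv kk r hL), scChi d L mv kk hL k (kingPr L kk r (cvM d L mv kk hL) x') ≠ 0 → ∀ μ, (scShift' d L mv kk r hL μ).symm x' ∈ (fun k => {z : ScX' d L mv kk r hL | ∃ y ∈ cvSk d L mv kk hL k, (unitTorusGeo L kk (cvM d L mv kk hL)).dist (scBlk' d L mv kk r hL z) y ≤ 3}) k ∧ ∀ t, t < L ^ r → kingSec (cvM d L mv kk hL) L kk r (kingPr L kk r (cvM d L mv kk hL) x') + t • unitVec (fine (L ^ r * L ^ kk) (cvM d L mv kk hL)) μ ∈ (fun k => {z : ScX' d L mv kk r hL | ∃ y ∈ cvSk d L mv kk hL k, (unitTorusGeo L kk (cvM d L mv kk hL)).dist (scBlk' d L mv kk r hL z) y ≤ 3}) k ∧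
      kingSec (cvM d L mv kk hL) L kk r ((scShift d L mv kk hL μ).symm (kingPr L kk r (cvM d L mv kk hL) x')) + t • unitVec (fine (L ^ r * L ^ kk) (cvM d L mv kk hL)) μ ∈ (fun k => {z : ScX' d L mv kk r hL | ∃ y ∈ cvSk d L mv kk hL k, (unitTorusGeo L kk (cvM d L mv kk hL)).dist (scBlk' d L mv kk r hL z) y ≤ 3}) k := fun k x' hχ μ =>
    ⟨hmono k _ (0 + 1) (by norm_num) (exists_tdist_le_succ (tdist_scBlk'_scShift'_symm_le μ x') (hd0 k x' hχ)), fun t ht => hQlA k x' hχ μ t ht⟩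
  have hfitA := sc_hfitA_of_pairing e u' hu' (fun μ z => (U' μ z : Matrix mm mm ℂ)) hU' (fun μ y => mprod (fun t => (U' μ (kingSec (cvM d L mv kk hL) L kk r y + t • unitVec (fine (L ^ r * L ^ kk) (cvM d L mv kk hL)) μ) : Matrix mm mm ℂ)) (L ^ r)) (fun μ y => rfl) (fun k => {z : ScX' d L mv kk r hL | ∃ y ∈ cvSk d L mv kk hL k, (unitTorusGeo L kk (cvM d L mv kk hL)).dist (scBlk' d L mv kk r hL z) y ≤ 3}) hp hΩ0 (fun k μ z hz => (hF1f k μ z hz).trans (mul_le_mul_of_nonneg_left hpf_le hη'.le)) hQlA hΩ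
  have hfitC := sc_hfitC_of_pairing e he u' hu' (fun μ z => (U' μ z : Matrix mm mm ℂ)) hU' (fun μ y => mprod (fun t => (U' μ (kingSec (cvM d L mv kk hL) L kk r y + t • unitVec (fine (L ^ r * L ^ kk) (cvM d L mv kk hL)) μ) : Matrix mm mm ℂ)) (L ^ r)) hU (fun μ y => rfl) (fun k => {z : ScX' d L mv kk r hL | ∃ y ∈ cvSk d L mv kk hL k, (unitTorusGeo L kk (cvM d L mv kk hL)).dist (scBlk' d L mv kk r hL z) y ≤ 3}) hp hΩ0 hoB (fun k μ z hz => (hF1f k μ z hz).trans (mul_le_mul_of_nonneg_left hpf_le hη'.le)) hQlC hΩ hB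
  -- the cut Gram perturbation defect PRODUCED (n15-c∕352)
  have hd0 : ∀ k (z : ScX' d L mv kk r hL), scBlk' d L mv kk r hL z ∈ cvSk d L mv kk hL k → ∃ y ∈ cvSk d L mv kk hL k, (unitTorusGeo L kk (cvM d L mv kk hL)).dist (scBlk' d L mv kk r hL z) y ≤ 3 := fun k z hz =>
    ⟨_, hz, (le_of_eq (tdistT_self _ _)).trans (by norm_num)⟩
  have hON : (0 : ℝ) ≤ (Fintype.card ι * (|aK a₀ (L : ℝ) (r + kk) - aK a₀ (L : ℝ) kk| * (1 + Fintype.card ι) + |aK a₀ (L : ℝ) kk| * (2 * Fintype.card ι * (@basisConst ι _ (Matrix mm mm ℂ) Matrix.frobeniusNormedAddCommGroup Matrix.frobeniusNormedSpace e * (2 * Real.sqrt (Fintype.card mm)) * (Real.sqrt (Fintype.card mm) * ((d + 1) * (d * ((((L ^ r * L ^ kk : ℕ) : ℝ)) * (((L ^ r : ℕ) : ℝ) * (((((L ^ r * L ^ kk : ℕ) : ℝ))⁻¹) ^ 2 * ((C / ξ ^ 2) * Real.exp (((((L ^ r * L ^ kk : ℕ) : ℝ))⁻¹) * (C / ξ))))))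 + ((1 + (((((L ^ r * L ^ kk : ℕ) : ℝ))⁻¹) * ((C / ξ) * Real.exp (((((L ^ r * L ^ kk : ℕ) : ℝ))⁻¹) * (C / ξ))))) ^ (L ^ r) - 1)))))))) := by
    have hE : (0 : ℝ) ≤ (1 + (((((L ^ r * L ^ kk : ℕ) : ℝ))⁻¹) * ((C / ξ) * Real.exp (((((L ^ r * L ^ kk : ℕ) : ℝ))⁻¹) * (C / ξ))))) ^ (L ^ r) - 1 := by
      have := one_le_pow₀ (M₀ := ℝ) (a := 1 + (((((L ^ r * L ^ kk : ℕ) : ℝ))⁻¹) * ((C / ξ) * Real.exp (((((L ^ r * L ^ kk : ℕ) : ℝ))⁻¹) * (C / ξ))))) (by nlinarith [mul_nonneg hη'.le hpf0]) (n := L ^ r); linarith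
    have := @basisConst_nonneg ι _ (Matrix mm mm ℂ) Matrix.frobeniusNormedAddCommGroup Matrix.frobeniusNormedSpace e
    positivity
  have hDNV := fun k => hasMaj_idef_scNV_pairing ι e he a₀ u' hu' (fun μ z => (U' μ z : Matrix mm mm ℂ)) hU' (fun μ y => mprod (fun t => (U' μ (kingSec (cvM d L mv kk hL) L kk r y + t • unitVec (fine (L ^ r * L ^ kk) (cvM d L mv kk hL)) μ) : Matrix mm mm ℂ)) (L ^ r)) (fun μ y => rfl) (ρ := (((((L ^ r * L ^ kk : ℕ) : ℝ))⁻¹) * ((C / ξ) * Real.exp (((((L ^ r * L ^ kk : ℕ) : ℝ))⁻¹) * (C / ξ))))) (b := (((((L ^ r * L ^ kk : ℕ) : ℝ))⁻¹) ^ 2 * ((C / ξ ^ 2) * Real.exp (((((L ^ r * L ^ kk : ℕ) : ℝ))⁻¹) * (C / ξ))))) (mul_nonneg hη'.le hpf0) hb0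
    (fun k μ z hz => hF1f k μ z (hd0 k z hz)) (fun k κ μ z hz => hstep k κ μ z (hd0 k z hz)) δ k
  exact H mv kk r hk hr hw₀' e he u' hu' (fun μ y => mprod (fun t => (U' μ (kingSec (cvM d L mv kk hL) L kk r y + t • unitVec (fine (L ^ r * L ^ kk) (cvM d L mv kk hL)) μ) : Matrix mm mm ℂ)) (L ^ r)) hU (fun μ z => (U' μ z : Matrix mm mm ℂ)) hU' (fun k => {z : ScX' d L mv kk r hL | ∃ y ∈ cvSk d L mv kk hL k, (unitTorusGeo L kk (cvM d L mv kk hL)).dist (scBlk' d L mv kk r hL z) y ≤ 3}) (fun k => {x : ScX d L mv kk hL | ∃ y ∈ cvSk d L mv kk hL k, (unitTorusGeo L kk (cvM d L mv kk hL)).dist (scBlk d L mv kk hL x) y ≤ 1}) (((1 + ((((L ^ r * L ^ kk : ℕ) : ℝ))⁻¹) * ((C / ξ) * Real.exp (((((L ^ r * L ^ kk : ℕ) : ℝ))⁻¹) * (C / ξ)))) ^ (L ^ r) - 1) / ((((L ^ kk : ℕ) : ℝ))⁻¹)) (((C / ξ ^ 2) * Real.exp (((((L ^ r * L ^ kk :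 ℕ) : ℝ))⁻¹) * (C / ξ))) * (1 + ((((L ^ r * L ^ kk : ℕ) : ℝ))⁻¹) * ((C / ξ) * Real.exp (((((L ^ r * L ^ kk : ℕ) : ℝ))⁻¹) * (C / ξ)))) ^ (L ^ r)) hp hq
    (fun k x' hx => ⟨⟨_, scBlk_kingPr_mem_cvSk_of_scChi'_ne_zero hM hm₁ hfitI hS0 hx, by rw [hblk x']; exact (le_of_eq (tdistT_self _ _)).trans (by norm_num)⟩, fun μ =>
      hmono k _ (0 + 1) (by norm_num) (exists_tdist_le_succ (tdist_scBlk'_scShift'_symm_le μ x') ⟨_, scBlk_kingPr_mem_cvSk_of_scChi'_ne_zero hM hm₁ hfitI hS0 hx, by rw [hblk x']; exact le_of_eq (tdistT_self _ _)⟩)⟩)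
    (fun k y' hy => ⟨_, hy, (le_of_eq (tdistT_self _ _)).trans (by norm_num)⟩)
    (fun k x hx => hcut k x hx)
    (fun k μ z hz => (hF1f k μ z hz).trans (mul_le_mul_of_nonneg_left hpf_le hη'.le))
    (fun k μ z hz => (hF2f k μ z hz).trans (mul_le_mul_of_nonneg_left hqf_le (sq_nonneg _)))
    (fun k μ x hx => (hC k μ x hx).1) (fun k μ x hx => (hC k μ x hx).2)
    rV oV (Fintype.card ι * (|aK a₀ (L : ℝ) (r + kk) - aK a₀ (L : ℝ) kk| * (1 + Fintype.card ι) + |aK a₀ (L : ℝ) kk| * (2 * Fintype.card ι * (@basisConst ι _ (Matrix mm mm ℂ) Matrix.frobeniusNormedAddCommGroup Matrix.frobeniusNormedSpace e * (2 * Real.sqrt (Fintype.card mm)) * (Real.sqrt (Fintype.card mm) * ((d + 1) * (d * ((((L ^ r * L ^ kk : ℕ) : ℝ)) * (((L ^ r : ℕ) : ℝ) * (((((L ^ r * L ^ kk : ℕ) : ℝ))⁻¹) ^ 2 * ((C / ξ ^ 2) * Real.exp (((((L ^ r * L ^ kk : ℕ) : ℝ))⁻¹) * (C / ξ)))))) +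 ((1 + (((((L ^ r * L ^ kk : ℕ) : ℝ))⁻¹) * ((C / ξ) * Real.exp (((((L ^ r * L ^ kk : ℕ) : ℝ))⁻¹) * (C / ξ))))) ^ (L ^ r) - 1)))))))) o hrV hoV hON hrA hrC hRle hole (fun k x' i => (hfitC k x' i).trans hoC) (fun k j' x' i => (hfitA k j' x' i).trans hoA) hDNV

end Final

end Summit.QuantumFields.YangMills.BalabanUVNodes.N15.Gluing

end
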